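import Literature.NumberTheory.Transcendental.AnalytificationSeparatedProofs
import Literature.AnabelianGeometry.AbsoluteAnabelian.AbsTopIII.KummerFaithfulProfiniteProofs
import HarnessLib

/-!
# [AbsTopIII] Def. 1.5 (a) for abelian varieties from the STRONG TOPOLOGY on `A(L)`
# (proof-only companion of `KummerFaithful.lean`, continuing `KummerFaithfulProfiniteProofs.lean`)

Mochizuki, *Topics in Absolute Anabelian Geometry III*, §1, Def. 1.5 p. 32 and Rmk. 1.5.4 (i) p. 33
("if `k` [...] is a finite extension of `ℚ_p`, then `A(k_H)` is an extension of a finitely generated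
`ℤ`-module by a compact abelian `p`-adic Lie group [...]. In particular, the condition of Definition
1.5, (a), is satisfied"), manuscript pagination (lit key `paper:url-5493eb38cbb7`).  Cell abc-iut,
FACT-LIST row **F-0369** `Rmk_1_5_4_i` (abelian-variety residual).

`KummerFaithfulProfiniteProofs.lean` reduced condition (a) for `A(k′)` to «`A(k′)` is a profinite
group».  This file supplies the topological half of that reduction for the STRONG topology of
`Literature.AlgebraicGeometry.Motives.AlgPoints` (Mumford, *Red Book* I.10; Conrad, Prop. 2.1):

* `AlgPoints.eq_of_forall_eval_top_eq` — on an AFFINE `k`-scheme, an `L`-point is determined by the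
  values of the global regular functions at it (`X ≅ Spec Γ(X)`);
* `AlgPoints.totallyDisconnectedSpace_of_isAffine` — hence for a field `L` whose topology is totally
  disconnected, `X(L)` is totally disconnected for affine `X` (continuous injection into `L^{Γ(X)}`);
* `AlgPoints.totallyDisconnectedSpace_of_compactSpace` — and for ANY `k`-scheme `X` whose `X(L)` is
  compact Hausdorff (affine charts `U(L) ↪ X(L)` are open embeddings,
  `AlgPoints.isOpenEmbedding_map_holds`; a compact open piece of a chart is clopen in `X(L)`);
* `AbelianVariety.isTopologicalGroup_points_of_isHomeomorph_prodEquiv` — `A(L)` is a topological group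
  as soon as `(A ×ₖ A)(L) ≃ A(L) × A(L)` is a homeomorphism (the named fact
  `AlgPoints.isHomeomorph_prodEquiv` of `AlgPoints.lean`; the group law is `map μ ∘ prodEquiv.symm`,
  inversion is `map ι`, both continuous by `AlgPoints.continuous_map`);
* `AbelianVariety.divisibleElementsTrivial_points_of_compactSpace` — **for an abelian variety `A/k`
  and a Hausdorff, totally disconnected topological field `L ⊇ k`: if `A(L)` is compact in the strong
  topology and `isHomeomorph_prodEquiv` holds at `(A, A, L)`, then `⋂_N A(L)^N = {1}`** (Def. 1.5 (a)),
  by `DivisibleElementsTrivial.of_profinite` and `t2Space_algPoints_holds`.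

So, for a finite extension `K` of `ℚ_p`, the abelian-variety clause of Kummer-faithfulness follows from
the two strong-topology named facts `compactSpace_algPoints_of_isProper A.X K` and
`AlgPoints.isHomeomorph_prodEquiv` (both `Literature/AlgebraicGeometry/Motives/AlgPoints.lean`, stated
there with locators Mumford I.10 Thm. 2 / Conrad Prop. 2.1, §5) — NOT from Mattuck's structure theorem.
Neither named fact is proved here: this is a REDUCTION of F-0369's residual, the row stays a named fact.
All declarations are theorems; nothing here bears on [IUTchIII] Cor. 3.12.
-/

noncomputable section

namespace Literature.AnabelianGeometry.AbsoluteAnabelian.AbsTopIII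

universe u

open _root_.CategoryTheory _root_.AlgebraicGeometry _root_.Topology
open Literature.AlgebraicGeometry.Motives
open Literature.NumberTheory.Transcendental

/-! ### Total disconnectedness of `X(L)` -/

section TotallyDisconnected

variable {k : Type u} [Field k] (X : SchemeOver k) (L : Type u) [Field L] [Algebra k L]

/-- **On an affine scheme an `L`-point is determined by the values of the global functions at it**:
`P.eval ⊤ s = Q.eval ⊤ s` for all `s ∈ Γ(X, 𝒪)` forces `P = Q` (the values are the ring homomorphism
`Γ(X) → L` of `P`, and `X ≅ Spec Γ(X)`). [cite: MumfordRedBook1999, I.10] -/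
theorem AlgPoints.eq_of_forall_eval_top_eq [IsAffine X.left] (P Q : AlgPoints X L)
    (h : ∀ s : Γ(X.left, ⊤), P.eval ⊤ trivial s = Q.eval ⊤ trivial s) : P = Q := by
  have happ : P.left.appTop = Q.left.appTop := by
    ext s
    have hs := h s
    rw [AlgPoints.eval_top, AlgPoints.eval_top] at hs
    exact (Scheme.ΓSpecIso (.of L)).commRingCatIsoToRingEquiv.injective hs
  haveI : IsAffine (specOver k L).left := inferInstanceAs (IsAffine (Spec (CommRingCat.of L)))
  have hleft : P.left = Q.left := by
    rw [← cancel_mono X.left.isoSpec.hom, ← Scheme.isoSpec_hom_naturality,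
      ← Scheme.isoSpec_hom_naturality, happ]
  exact Over.OverMorphism.ext hleft

variable [TopologicalSpace L]

/-- **`X(L)` is totally disconnected for affine `X` and totally disconnected `L`**: the evaluation map
`X(L) → L^{Γ(X, 𝒪)}` is continuous (`AlgPoints.continuous_eval_top`) and injective
(`eq_of_forall_eval_top_eq`), and `L^{Γ(X, 𝒪)}` is totally disconnected. [cite: MumfordRedBook1999, I.10] -/
theorem AlgPoints.totallyDisconnectedSpace_of_isAffine [IsAffine X.left] [TotallyDisconnectedSpace L] :
    TotallyDisconnectedSpace (AlgPoints X L) := by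
  let e : AlgPoints X L → (Γ(X.left, ⊤) → L) := fun P s => P.eval ⊤ trivial s
  have he : Continuous e := continuous_pi fun s => AlgPoints.continuous_eval_top s
  have hinj : Function.Injective e := fun P Q hPQ =>
    AlgPoints.eq_of_forall_eval_top_eq X L P Q fun s => congrFun hPQ s
  refine ⟨isTotallyDisconnected_of_image he.continuousOn hinj ?_⟩
  exact isTotallyDisconnected_of_totallyDisconnectedSpace _

/-- Every `L`-point of `X` lies in the (open) range of the chart `U(L) ↪ X(L)` of some affine open
`U ⊆ X`, and that range is a totally disconnected subset when `L` is.
[cite: MumfordRedBook1999, I.10] -/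
theorem AlgPoints.exists_isOpen_isTotallyDisconnected_mem [TotallyDisconnectedSpace L]
    (P : AlgPoints X L) :
    ∃ W : Set (AlgPoints X L), IsOpen W ∧ IsTotallyDisconnected W ∧ P ∈ W := by
  obtain ⟨U, hU, hPU, -⟩ :=
    exists_isAffineOpen_mem_and_subset (X := X.left) (U := ⊤) (x := P.pt) trivial
  let U' : SchemeOver k := Over.mk (U.ι ≫ X.hom)
  let ιU : U' ⟶ X := Over.homMk U.ι rfl
  haveI : IsOpenImmersion ιU.left := inferInstanceAs (IsOpenImmersion U.ι)
  haveI : IsAffine U'.left := hU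
  have hemb : IsOpenEmbedding (AlgPoints.map ιU : AlgPoints U' L → AlgPoints X L) :=
    AlgPoints.isOpenEmbedding_map_holds ιU
  have hPU' : P.pt ∈ ιU.left.opensRange := by
    change P.pt ∈ U.ι.opensRange
    rwa [Scheme.Opens.opensRange_ι]
  haveI := AlgPoints.totallyDisconnectedSpace_of_isAffine U' L
  refine ⟨Set.range (AlgPoints.map ιU), hemb.isOpen_range,
    hemb.isEmbedding.isTotallyDisconnected_range.mpr inferInstance, ?_⟩
  exact ⟨AlgPoints.liftOfMemOpensRange ιU P hPU', AlgPoints.map_liftOfMemOpensRange ιU P hPU'⟩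

/-- **`X(L)` is totally disconnected whenever it is compact Hausdorff and `L` is totally
disconnected** (any `k`-scheme `X`): every point has an open neighbourhood `W` (an affine chart) which
is totally disconnected; `W` is locally compact Hausdorff, so it has a basis of compact clopen sets, and a
compact open subset of `W` is clopen in `X(L)`; hence distinct points are separated by clopen sets.
[cite: MumfordRedBook1999, I.10] -/
theorem AlgPoints.totallyDisconnectedSpace_of_compactSpace [TotallyDisconnectedSpace L]
    [CompactSpace (AlgPoints X L)] [T2Space (AlgPoints X L)] :
    TotallyDisconnectedSpace (AlgPoints X L) := by
  -- it suffices to separate points by clopen sets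
  suffices h : TotallySeparatedSpace (AlgPoints X L) by infer_instance
  rw [totallySeparatedSpace_iff_exists_isClopen]
  intro P Q hPQ
  obtain ⟨W, hWo, hWtd, hPW⟩ := AlgPoints.exists_isOpen_isTotallyDisconnected_mem X L P
  -- work in the open subspace `W`: locally compact, Hausdorff, totally disconnected
  haveI : TotallyDisconnectedSpace W := totallyDisconnectedSpace_subtype_iff.mpr hWtd
  haveI : LocallyCompactSpace W := hWo.locallyCompactSpace
  let P' : W := ⟨P, hPW⟩
  -- a compact neighbourhood `K` of `P'` in `W`, and the open set `interior K ∖ {Q}`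
  obtain ⟨K, hK, hKP⟩ := exists_compact_mem_nhds P'
  have hO : IsOpen (interior K ∩ (Subtype.val ⁻¹' ({Q}ᶜ : Set (AlgPoints X L)) : Set W)) :=
    isOpen_interior.inter ((isOpen_compl_singleton (x := Q)).preimage continuous_subtype_val)
  have hP'O : P' ∈ interior K ∩ (Subtype.val ⁻¹' ({Q}ᶜ : Set (AlgPoints X L)) : Set W) :=
    ⟨mem_interior_iff_mem_nhds.mpr hKP, fun h => hPQ h⟩
  -- a clopen (in `W`) neighbourhood `C` of `P'` inside it: compact, since closed in `K`
  obtain ⟨C, hCclopen, hP'C, hCO⟩ :=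
    (loc_compact_Haus_tot_disc_of_zero_dim (H := W)).exists_subset_of_mem_open hP'O hO
  have hCcpt : IsCompact C :=
    hK.of_isClosed_subset hCclopen.1 (hCO.trans (Set.inter_subset_left.trans interior_subset))
  -- its image in `X(L)` is compact (hence closed) and open (open in an open subspace)
  refine ⟨Subtype.val '' C,
    ⟨(hCcpt.image continuous_subtype_val).isClosed, hWo.isOpenMap_subtype_val C hCclopen.2⟩,
    ⟨P', hP'C, rfl⟩, ?_⟩
  rintro ⟨x, hxC, hxQ⟩
  exact (hCO hxC).2 hxQ

end TotallyDisconnected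

/-! ### `A(L)` is a topological group when products carry the product topology -/

section TopologicalGroup

variable {k : Type u} [Field k] (A : AbelianVariety k) (L : Type u) [Field L] [Algebra k L]
  [TopologicalSpace L]

open scoped MonObj
open _root_.CategoryTheory.MonoidalCategory

omit [TopologicalSpace L] in
/-- The group law on `A(L)` is `map μ` after the pairing `prodEquiv.symm` (Mathlib `Hom.mul_def`).
[cite: MumfordRedBook1999, I.10] -/
theorem AbelianVariety.points_mul_eq (P Q : A.Points L) :
    P * Q = AlgPoints.map μ[A.X] (AlgPoints.prodEquiv.symm (P, Q)) := rfl

omit [TopologicalSpace L] in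
/-- Inversion on `A(L)` is `map ι` (Mathlib `Hom.inv_def`). [cite: MumfordRedBook1999, I.10] -/
theorem AbelianVariety.points_inv_eq (P : A.Points L) : P⁻¹ = AlgPoints.map ι[A.X] P := rfl

/-- **`A(L)` is a topological group for the strong topology** whenever `(A ×ₖ A)(L) ≃ A(L) × A(L)` is
a homeomorphism (the named fact `AlgPoints.isHomeomorph_prodEquiv`, which presupposes a Hausdorff
topological field `L`): multiplication is `map μ ∘ prodEquiv.symm` and inversion is `map ι`, and
`map` of a morphism is continuous. [cite: ConradAdelicPoints2012, Prop. 2.1] -/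
theorem AbelianVariety.isTopologicalGroup_points_of_isHomeomorph_prodEquiv
    [IsTopologicalDivisionRing L] [T2Space L]
    (hprod : AlgPoints.isHomeomorph_prodEquiv (X := A.X) (Y := A.X) (L := L)) :
    IsTopologicalGroup (A.Points L) := by
  have hh : IsHomeomorph
      (AlgPoints.prodEquiv : AlgPoints (A.X ⊗ A.X) L ≃ A.Points L × A.Points L) := hprod
  have hsymm : Continuous
      (AlgPoints.prodEquiv.symm : A.Points L × A.Points L → AlgPoints (A.X ⊗ A.X) L) := by
    refine continuous_def.mpr fun U hU => ?_
    rw [← Equiv.image_eq_preimage_symm]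
    exact hh.isOpenMap U hU
  have hmul : Continuous fun p : A.Points L × A.Points L => p.1 * p.2 := by
    have : (fun p : A.Points L × A.Points L => p.1 * p.2) =
        AlgPoints.map μ[A.X] ∘ AlgPoints.prodEquiv.symm := by
      funext p
      exact AbelianVariety.points_mul_eq A L p.1 p.2
    rw [this]
    exact (AlgPoints.continuous_map _).comp hsymm
  have hinv : Continuous fun P : A.Points L => P⁻¹ := by
    have : (fun P : A.Points L => P⁻¹) = AlgPoints.map ι[A.X] := by
      funext P
      exact AbelianVariety.points_inv_eq A L P
    rw [this]
    exact AlgPoints.continuous_map _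
  exact { continuous_mul := hmul, continuous_inv := hinv }

end TopologicalGroup

/-! ### Def. 1.5 (a) for `A(L)` from compactness of the strong topology -/

section Divisible

variable {k : Type u} [Field k] (A : AbelianVariety k) (L : Type u) [Field L] [Algebra k L]
  [TopologicalSpace L] [IsTopologicalDivisionRing L] [T2Space L] [TotallyDisconnectedSpace L]

/-- **Def. 1.5 (a) for an abelian variety from the strong topology.**  Let `A` be an abelian variety
over `k` and `L ⊇ k` a Hausdorff topological field whose topology is totally disconnected (e.g. any
non-archimedean valued field).  If `A(L)` is compact in the strong topology (the named fact
`compactSpace_algPoints_of_isProper A.X L` for locally compact `L`) and `(A ×ₖ A)(L) ≃ A(L) × A(L)` is a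
homeomorphism (the named fact `AlgPoints.isHomeomorph_prodEquiv`), then `⋂_{N ≥ 1} A(L)^N = {1}`:
`A(L)` is then a compact (hypothesis), Hausdorff (`t2Space_algPoints_holds`, `A` separated), totally
disconnected (`AlgPoints.totallyDisconnectedSpace_of_compactSpace`) topological group
(`isTopologicalGroup_points_of_isHomeomorph_prodEquiv`), i.e. profinite, and profinite groups have no
divisible elements (`DivisibleElementsTrivial.of_profinite`).  Mattuck's structure theorem is not used.
[cite: MochizukiAbsTopIII2015, Rmk 1.5.4 (i) p.33] -/
theorem AbelianVariety.divisibleElementsTrivial_points_of_compactSpace [CompactSpace (A.Points L)]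
    (hprod : AlgPoints.isHomeomorph_prodEquiv (X := A.X) (Y := A.X) (L := L)) :
    DivisibleElementsTrivial (A.Points L) := by
  haveI : IsTopologicalGroup (A.Points L) :=
    AbelianVariety.isTopologicalGroup_points_of_isHomeomorph_prodEquiv A L hprod
  haveI : T2Space (A.Points L) := t2Space_algPoints_of_isTopologicalRing A.X L
  haveI : TotallyDisconnectedSpace (A.Points L) :=
    AlgPoints.totallyDisconnectedSpace_of_compactSpace A.X L
  exact DivisibleElementsTrivial.of_profinite (A.Points L)

end Divisible

/-! ### The reduction of F-0369's abelian-variety residual to the two strong-topology facts -/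

section KummerFaithful

variable {k : Type u} [Field k]

/-- **Kummer-faithfulness from toral Kummer-faithfulness and the strong topology.**  If `k` is torally
Kummer-faithful and every finite extension `k′` of `k` carries a Hausdorff, totally disconnected field
topology for which, for every abelian variety `A/k′`, `A(k′)` is compact and `isHomeomorph_prodEquiv`
holds at `(A, A, k′)`, then `k` is Kummer-faithful.  For `k` a finite extension of `ℚ_p` the topology is
the `p`-adic one and the two inputs are the named facts `compactSpace_algPoints_of_isProper` /
`AlgPoints.isHomeomorph_prodEquiv` of `AlgPoints.lean`; the torus half is the tree's
`isTorallyKummerFaithful_of_finite_padic`.  REDUCTION of FACT-LIST row F-0369, not a discharge.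
[cite: MochizukiAbsTopIII2015, Rmk 1.5.4 (i) p.33] -/
theorem IsKummerFaithful.of_isTorallyKummerFaithful_of_strongTopology (hk : IsTorallyKummerFaithful k)
    (h : ∀ (k' : Type u) [Field k'] [Algebra k k'], Module.Finite k k' →
      ∃ t : TopologicalSpace k', letI := t
        IsTopologicalDivisionRing k' ∧ T2Space k' ∧ TotallyDisconnectedSpace k' ∧
          ∀ A : AbelianVariety k', CompactSpace (A.Points k') ∧
            AlgPoints.isHomeomorph_prodEquiv (X := A.X) (Y := A.X) (L := k')) :
    IsKummerFaithful k := by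
  refine ⟨hk, fun k' _ _ hfin A => ?_⟩
  obtain ⟨t, htr, ht2, htd, hA⟩ := h k' hfin
  letI : TopologicalSpace k' := t
  obtain ⟨hc, hprod⟩ := hA A
  exact AbelianVariety.divisibleElementsTrivial_points_of_compactSpace A k' hprod

end KummerFaithful

end Literature.AnabelianGeometry.AbsoluteAnabelian.AbsTopIII

end
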